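import Summits.QuantumFields.BalabanUV.T4Continuum.Support.OutputRateOpHolomorphic

/-!
# OutputRateOpGaussian — the (H-dom) mechanism of `OutputRateOpHolomorphic` MADE A THEOREM for COMPLEX GAUSSIAN TERMS in any finite
# dimension: a Gaussian integral `∫_V g(v)·exp(−q(o, v)) dv` whose complex quadratic exponent depends holomorphically on the operator
# datum `o` is a dominated holomorphic parametric integral on every operator domain carrying a POSITIVITY MARGIN `Re q(o, v) ≥ m‖v‖²`
# (cell `pub-balaban`, T⁴ fan-out, `HOME/BINDER-OWNERS.md` row NE5, owner lineage t4-ne5-p1, gen 28, route P1)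

HONEST FRAMING (T4-DAG PAGE 1).  Rung (B)+1 on ONE finite four-torus of fixed physical size — NOT infinite volume, NOT a mass gap, NOT
the Clay problem; `FlowStep.BetaPertH`, (B), (B^μ) do not occur here.  NE5 (`T4OutputRate.NE5`) is NOT PRINTED and NOT PROVED (spine
0/9, unchanged).  Nothing of Bałaban's series is asserted; 0 cite tags (the located print — [II] = [Balaban1988RG2Cluster] p. 15 (2.14):
the resummed term is an integral against `dμ₀(X)` and the Gaussian `dμ_{C^{(k)}(Z₀,σ(Z))}(B)` of `exp(−½⟨ΓX, CΓX⟩)·exp(−⟨B, ΓX⟩)·χ·χ^c·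
exp[Σ τ(Y)𝐕_k(Y,B)]` with «the operators in it … not symmetric, and the second measure … complex», and (2.15)–(2.17) p. 16: the
perturbative operator-replacement estimate — is quoted verbatim in the lineage's loci sheet and the Literature leaf
`T4InputCauchyRateData` §11).  HONEST DEPENDENCY (cell, verbatim): continuum YM on T⁴ ⇐ BetaPertH ∧ nine spine estimates (0/9 proved);
BetaPertH ⇐ (D1) ∧ (D4) ∧ CAP+tail; G-an2-4 gates asym, D1 and NE2/3/4.

WHAT THIS MODULE IS.  `OutputRateOpHolomorphic` (p213179) relocated the operator half of wall W2 to (H-rep) ∧ (H-hol) ∧ (H-meas) ∧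
(H-dom), (H-dom) = a locally uniform integrable majorant of the (2.14) integrand on the operator domain.  On a FINITE torus the
fluctuation fields of one step live in a finite-dimensional real inner product space `V`, and the Gaussian factors of (2.14), written as
densities, are `exp(−q(o, v))` with a quadratic exponent `q` depending on the operator datum `o`.  Here, for that class:
* §1 `norm_mul_cexp_neg_le` — POSITIVITY MARGIN ⟹ GAUSSIAN MAJORANT: `Re q(o, v) ≥ m‖v‖²` on the operator domain and an insertion of
  Gaussian growth at most half the margin, `‖g v‖ ≤ G₀e^{(m/2)‖v‖²}` (bounded insertions, characteristic functions, polynomials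
  absorbed), give `‖g(v)e^{−q(o,v)}‖ ≤ G₀e^{−(m/2)‖v‖²}`; `integrable_const_mul_exp_neg_mul_sq_norm`, `integral_const_mul_exp_neg_mul_sq_norm`
  (mass `G₀(π/(m/2))^{dim V/2}`, Mathlib's `GaussianFourier.integral_rexp_neg_mul_sq_norm`).
* §2 **`differentiableOn_gaussianTerm`** — on an OPEN operator domain `𝒪` with margin `m > 0`, measurable data and `q(·, v)` holomorphic
  on `𝒪`: `o ↦ ∫ g(v)e^{−q(o,v)} dv` is complex differentiable on `𝒪` and bounded by the mass (the engine
  `Literature.Analysis.Complex.differentiableOn_integral_of_dominated` BY NAME) — (H-hol), (H-meas), (H-dom) DISCHARGED for the class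
  from the margin alone.
* §3 THE AFFINE MARGIN (the printed KIND of (2.15)–(2.17): complex operator = positive operator + small perturbation): for
  `q(o, v) = q₀(v) + ℓ(v)(o − c)` with `Re q₀(v) ≥ m₀‖v‖²` and `‖ℓ(v)‖ ≤ m₁‖v‖²`, the margin on `ball c R′` is `m₀ − m₁R′`
  (`re_affineExponent_ge`), holomorphy is automatic (`differentiable_affineExponent`).
* §4 THE HOOK: the hypothesis shape `TermOpGaussian T W ctr RHist R′ gIns q m G₀` (every term of the expansion is, on the open operator
  ball of radius `R′ k` around the class centre, such a Gaussian integral over a finite-dimensional `α k i` with margin `m > 0`) ⟹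
  `TermOpHolomorphicBall` (**`termOpHolomorphicBall_of_gaussian`**) ⟹ `TermOpLineAnalytic` on the ball class (`termOpLineAnalytic_of_gaussian`)
  and, with the budget `G₀·(π/(m/2))^{dim/2} ≤ a k i·e^{−κd(X)}`, `TermBound` (`termBound_of_gaussian`).

STATUS (census).  For Bałaban's (2.14) this leaves, of the operator half of W2: (H-rep) the dictionary (term = such an integral; the
`σ`/`τ` contour and `s`/`t` interpolation integrals and the outer `dμ₀(X)` either absorbed in `V` or treated as a finite product of such
factors) and the MARGIN itself — `Re` of the (2.14) quadratic forms `½⟨ΓX, CΓX⟩ + ½⟨B, C⁻¹B⟩ + ⟨B, ΓX⟩ − Σ τ(Y)·½⟨Q(Y)B, B⟩` bounded below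
by `m‖(X, B)‖²` UNIFORMLY on the complex operator ball (printed KIND: positivity of `C^{(k)}`, `Δ_k` at real data, [II] p. 15/16, and the
smallness (1.43) of `Q`; the uniformity over the ball of radius `rOp` is the re-reading «`R₁ ↦ R₁ + ζ·displacement`» of (2.16), NOT
PRINTED, not citable under the ABSOLUTE RULE) — and the non-Gaussian remainder `V″_k` of (1.42) inside the insertion `g` (bounded by
(1.36) on the analyticity domain).  No wall is discharged from print; S and the exponent untouched; NE5 NOT PROVED; spine 0/9; rung (B)+1
finite T⁴; NOT infinite volume / mass gap / Clay.  0 sorry; axioms ⊆ {propext, Classical.choice, Quot.sound}.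
-/

noncomputable section

open Set Metric MeasureTheory Filter
open scoped RealInnerProductSpace

namespace Summit.QuantumFields.BalabanUV.T4Continuum.OutputRateOpGaussian

open Literature.MathematicalPhysics.QuantumFieldTheory.Balaban1983to89
open Literature.MathematicalPhysics.QuantumFieldTheory.Balaban1983to89.T4OutputRate
open Literature.MathematicalPhysics.QuantumFieldTheory.Balaban1983to89.T4InputCauchyRate
open Literature.MathematicalPhysics.QuantumFieldTheory.Balaban1983to89.T4InputCauchyRateData
open Literature.MathematicalPhysics.QuantumFieldTheory.Balaban1983to89.T4InputCauchyRateSpecies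
open Literature.MathematicalPhysics.QuantumFieldTheory.Balaban1983to89.T4InputCauchyRateTermwise
open Summit.QuantumFields.BalabanUV.T4Continuum.OutputRateOpHolomorphic

/-! ## §1 Positivity margin ⟹ Gaussian majorant; its integrability and mass -/

section Majorant

variable {V : Type*} [NormedAddCommGroup V] {Op : Type*}

/-- The norm of a complex Gaussian density: `‖exp(−z)‖ = e^{−Re z}`. [folklore] -/
theorem norm_cexp_neg (z : ℂ) : ‖Complex.exp (-z)‖ = Real.exp (-z.re) := by
  rw [Complex.norm_exp, Complex.neg_re]

/-- **POSITIVITY MARGIN ⟹ GAUSSIAN MAJORANT**: if `Re q(o, v) ≥ m‖v‖²` for `o` in the operator domain `𝒪` and the insertion has Gaussian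
growth at most half the margin, `‖g v‖ ≤ G₀·e^{(m/2)‖v‖²}`, then `‖g(v)·exp(−q(o, v))‖ ≤ G₀·e^{−(m/2)‖v‖²}` on `𝒪`. [folklore] -/
theorem norm_mul_cexp_neg_le {g : V → ℂ} {G₀ m : ℝ} {q : Op → V → ℂ} {𝒪 : Set Op}
    (hg : ∀ v, ‖g v‖ ≤ G₀ * Real.exp (m / 2 * ‖v‖ ^ 2)) (hq : ∀ o ∈ 𝒪, ∀ v, m * ‖v‖ ^ 2 ≤ (q o v).re) {o : Op} (ho : o ∈ 𝒪)
    (v : V) : ‖g v * Complex.exp (-q o v)‖ ≤ G₀ * Real.exp (-(m / 2) * ‖v‖ ^ 2) := by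
  have hG₀ : 0 ≤ G₀ := by
    have h := (norm_nonneg _).trans (hg v)
    exact nonneg_of_mul_nonneg_left (by simpa [mul_comm] using h) (Real.exp_pos _)
  rw [norm_mul, norm_cexp_neg]
  calc ‖g v‖ * Real.exp (-(q o v).re)
      ≤ G₀ * Real.exp (m / 2 * ‖v‖ ^ 2) * Real.exp (-(m * ‖v‖ ^ 2)) :=
        mul_le_mul (hg v) (Real.exp_le_exp.2 (neg_le_neg (hq o ho v))) (Real.exp_pos _).le
          (mul_nonneg hG₀ (Real.exp_pos _).le)
    _ = G₀ * Real.exp (-(m / 2) * ‖v‖ ^ 2) := by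
        rw [mul_assoc, ← Real.exp_add]; ring_nf

/-- The real Gaussian as the norm of the complex one: `‖exp(−b‖v‖²)‖ = e^{−b‖v‖²}` (coercions). [folklore] -/
theorem norm_cexp_neg_mul_sq_norm (b : ℝ) (v : V) :
    ‖Complex.exp (-(b : ℂ) * ((‖v‖ : ℝ) : ℂ) ^ 2)‖ = Real.exp (-b * ‖v‖ ^ 2) := by
  rw [Complex.norm_exp, show (-(b : ℂ) * ((‖v‖ : ℂ)) ^ 2) = (((-b * ‖v‖ ^ 2 : ℝ)) : ℂ) by push_cast; ring, Complex.ofReal_re]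

variable [InnerProductSpace ℝ V] [FiniteDimensional ℝ V] [MeasurableSpace V] [BorelSpace V]

/-- The Gaussian majorant `G₀·e^{−b‖v‖²}` is integrable on the finite-dimensional `V` (`b > 0`; Mathlib's
`GaussianFourier.integrable_cexp_neg_mul_sq_norm_add`). [folklore] -/
theorem integrable_const_mul_exp_neg_mul_sq_norm {b : ℝ} (hb : 0 < b) (G₀ : ℝ) :
    Integrable fun v : V => G₀ * Real.exp (-b * ‖v‖ ^ 2) := by
  have h := GaussianFourier.integrable_cexp_neg_mul_sq_norm_add (V := V) (b := b) (by simpa using hb) 0 0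
  simp only [zero_mul, add_zero] at h
  exact ((h.norm.congr (Eventually.of_forall fun v => norm_cexp_neg_mul_sq_norm b v))).const_mul G₀

/-- Its MASS: `∫ G₀·e^{−b‖v‖²} dv = G₀·(π/b)^{dim V/2}` (Mathlib's `GaussianFourier.integral_rexp_neg_mul_sq_norm`). [folklore] -/
theorem integral_const_mul_exp_neg_mul_sq_norm {b : ℝ} (hb : 0 < b) (G₀ : ℝ) :
    ∫ v : V, G₀ * Real.exp (-b * ‖v‖ ^ 2) = G₀ * (Real.pi / b) ^ (Module.finrank ℝ V / 2 : ℝ) := by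
  rw [integral_const_mul, GaussianFourier.integral_rexp_neg_mul_sq_norm hb]

end Majorant

/-! ## §2 Complex Gaussian terms are dominated holomorphic parametric integrals on any open operator domain with a margin -/

section GaussianTerm

variable {V : Type*} [NormedAddCommGroup V] [InnerProductSpace ℝ V] [FiniteDimensional ℝ V] [MeasurableSpace V] [BorelSpace V]
variable {Op : Type*} [NormedAddCommGroup Op] [NormedSpace ℂ Op]

/-- The four clauses of a dominated holomorphic parametric integral, DISCHARGED for a complex Gaussian term from the margin: on an open
operator domain `𝒪` with `Re q(o, v) ≥ m‖v‖²` (`m > 0`), `q(·, v)` holomorphic on `𝒪`, `q(o, ·)` and `g` a.e.-strongly measurable,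
`‖g v‖ ≤ G₀e^{(m/2)‖v‖²}`: the integrand `g(v)e^{−q(o,v)}` is a.e.-strongly measurable for `o ∈ 𝒪`, holomorphic in `o` on `𝒪` for every
`v`, and dominated on ALL of `𝒪` by the integrable `G₀e^{−(m/2)‖v‖²}`. [folklore] -/
theorem gaussianTerm_clauses {g : V → ℂ} {G₀ m : ℝ} (hm : 0 < m) {q : Op → V → ℂ} {𝒪 : Set Op}
    (hg_meas : AEStronglyMeasurable g volume) (hg : ∀ v, ‖g v‖ ≤ G₀ * Real.exp (m / 2 * ‖v‖ ^ 2))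
    (hq_meas : ∀ o ∈ 𝒪, AEStronglyMeasurable (q o) volume) (hq_hol : ∀ v, DifferentiableOn ℂ (fun o => q o v) 𝒪)
    (hq_re : ∀ o ∈ 𝒪, ∀ v, m * ‖v‖ ^ 2 ≤ (q o v).re) :
    (∀ o ∈ 𝒪, AEStronglyMeasurable (fun v => g v * Complex.exp (-q o v)) volume) ∧
    (∀ᵐ v ∂(volume : Measure V), DifferentiableOn ℂ (fun o => g v * Complex.exp (-q o v)) 𝒪) ∧
    (Integrable (fun v : V => G₀ * Real.exp (-(m / 2) * ‖v‖ ^ 2)) ∧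
      ∀ᵐ v ∂(volume : Measure V), ∀ o ∈ 𝒪, ‖g v * Complex.exp (-q o v)‖ ≤ G₀ * Real.exp (-(m / 2) * ‖v‖ ^ 2)) := by
  refine ⟨fun o ho => hg_meas.mul (Complex.continuous_exp.comp_aestronglyMeasurable (hq_meas o ho).neg),
    Eventually.of_forall fun v => ((hq_hol v).neg.cexp).const_mul (g v),
    integrable_const_mul_exp_neg_mul_sq_norm (half_pos hm) G₀,
    Eventually.of_forall fun v o ho => norm_mul_cexp_neg_le hg hq_re ho v⟩

/-- **COMPLEX GAUSSIAN TERMS ARE HOLOMORPHIC IN THE OPERATOR DATUM, WITH THE GAUSSIAN BOUND** — (H-hol) ∧ (H-meas) ∧ (H-dom) of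
`OutputRateOpHolomorphic` from the margin alone: on an OPEN operator domain `𝒪` as in `gaussianTerm_clauses`,
`o ↦ ∫ g(v)e^{−q(o,v)} dv` is complex differentiable on `𝒪` (engine `Literature.Analysis.Complex.differentiableOn_integral_of_dominated`)
and `‖∫ g(v)e^{−q(o,v)} dv‖ ≤ G₀·(π/(m/2))^{dim V/2}` there. [folklore] -/
theorem differentiableOn_gaussianTerm {g : V → ℂ} {G₀ m : ℝ} (hm : 0 < m) {q : Op → V → ℂ} {𝒪 : Set Op} (h𝒪 : IsOpen 𝒪)
    (hg_meas : AEStronglyMeasurable g volume) (hg : ∀ v, ‖g v‖ ≤ G₀ * Real.exp (m / 2 * ‖v‖ ^ 2))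
    (hq_meas : ∀ o ∈ 𝒪, AEStronglyMeasurable (q o) volume) (hq_hol : ∀ v, DifferentiableOn ℂ (fun o => q o v) 𝒪)
    (hq_re : ∀ o ∈ 𝒪, ∀ v, m * ‖v‖ ^ 2 ≤ (q o v).re) :
    DifferentiableOn ℂ (fun o => ∫ v, g v * Complex.exp (-q o v)) 𝒪 ∧
      ∀ o ∈ 𝒪, ‖∫ v, g v * Complex.exp (-q o v)‖ ≤ G₀ * (Real.pi / (m / 2)) ^ (Module.finrank ℝ V / 2 : ℝ) := by
  obtain ⟨hmeas, hdiff, hint, hdom⟩ := gaussianTerm_clauses hm hg_meas hg hq_meas hq_hol hq_re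
  refine ⟨Literature.Analysis.Complex.differentiableOn_integral_of_dominated hmeas hdiff fun o₀ ho₀ => ?_, fun o ho => ?_⟩
  · obtain ⟨R, hR, hsub⟩ := Metric.isOpen_iff.1 h𝒪 o₀ ho₀
    exact ⟨R, hR, hsub, _, hint, by filter_upwards [hdom] with v hv o ho using hv o (hsub ho)⟩
  · rw [← integral_const_mul_exp_neg_mul_sq_norm (half_pos hm) G₀]
    exact norm_integral_le_of_majorant hint (by filter_upwards [hdom] with v hv using hv o ho)

end GaussianTerm

/-! ## §3 The affine margin: positive part + small holomorphic (here: affine) operator perturbation -/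

section Affine

variable {V : Type*} {Op : Type*} [NormedAddCommGroup Op] [NormedSpace ℂ Op]

/-- The AFFINE exponent `q(o, v) = q₀(v) + ℓ(v)(o − c)` is entire in the operator datum. [folklore] -/
theorem differentiable_affineExponent (q₀ : V → ℂ) (ℓ : V → (Op →L[ℂ] ℂ)) (c : Op) (v : V) :
    Differentiable ℂ fun o : Op => q₀ v + ℓ v (o - c) := by
  fun_prop

/-- **THE AFFINE MARGIN** (printed KIND: [II] (2.15)–(2.17) — the complex operators are the positive ones plus a perturbation small in
norm): if `Re q₀(v) ≥ m₀‖v‖²` and `‖ℓ(v)‖ ≤ m₁‖v‖²`, then on the operator ball `‖o − c‖ < R′` the exponent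
`q(o, v) = q₀(v) + ℓ(v)(o − c)` keeps the margin `Re q(o, v) ≥ (m₀ − m₁R′)‖v‖²`. [folklore] -/
theorem re_affineExponent_ge [NormedAddCommGroup V] {q₀ : V → ℂ} {ℓ : V → (Op →L[ℂ] ℂ)} {c : Op} {m₀ m₁ R' : ℝ} (hm₁ : 0 ≤ m₁)
    (hq₀ : ∀ v, m₀ * ‖v‖ ^ 2 ≤ (q₀ v).re) (hℓ : ∀ v, ‖ℓ v‖ ≤ m₁ * ‖v‖ ^ 2) {o : Op} (ho : o ∈ ball c R') (v : V) :
    (m₀ - m₁ * R') * ‖v‖ ^ 2 ≤ (q₀ v + ℓ v (o - c)).re := by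
  rw [mem_ball, dist_eq_norm] at ho
  have h1 : ‖ℓ v (o - c)‖ ≤ m₁ * ‖v‖ ^ 2 * R' :=
    ((ℓ v).le_opNorm _).trans (mul_le_mul (hℓ v) ho.le (norm_nonneg _) (mul_nonneg hm₁ (sq_nonneg _)))
  have h2 : -(m₁ * ‖v‖ ^ 2 * R') ≤ (ℓ v (o - c)).re :=
    (neg_le_neg h1).trans (abs_le.1 (Complex.abs_re_le_norm _)).1
  rw [Complex.add_re]
  nlinarith [hq₀ v]

end Affine

/-! ## §4 The hook: complex Gaussian term families ⟹ `TermOpHolomorphicBall` ⟹ `TermOpLineAnalytic` / `TermBound` -/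

section Hook

variable {C : Carriers} {Op Hist : Type*} [NormedAddCommGroup Op] [NormedSpace ℂ Op] [NormedAddCommGroup Hist]
  [NormedSpace ℂ Hist] {ι : Type*} (T : ℕ → ι → Op → Hist → C.Dom → ℂ)
  {α : ℕ → ι → Type*} [∀ k i, NormedAddCommGroup (α k i)] [∀ k i, InnerProductSpace ℝ (α k i)]
  [∀ k i, FiniteDimensional ℝ (α k i)] [∀ k i, MeasurableSpace (α k i)] [∀ k i, BorelSpace (α k i)]

/-- HYPOTHESIS SHAPE `TermOpGaussian T W ctr RHist R′ gIns q m G₀` ([analysis]; our dictionary for the Gaussian factors of (2.14) on a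
finite torus, asserted nowhere): for every history datum of the class's history ball, step-`k` domain `X` and term index `i`, on the open
operator ball of radius `R′ k` around the class centre the term IS the complex Gaussian integral `∫ gIns(v)·exp(−q(o, v)) dv` over the
finite-dimensional real inner product space `α k i` (Lebesgue measure), with: margin `m > 0`, `Re q(o, v) ≥ m‖v‖²` on the ball;
`q(·, v)` holomorphic on the ball; `q(o, ·)`, `gIns` a.e.-strongly measurable; insertion growth `‖gIns v‖ ≤ G₀e^{(m/2)‖v‖²}`. [folklore] -/
def TermOpGaussian (W : Set (ℕ → ℝ)) (ctr : ℕ → (ℕ → ℝ) → C.BgB → Op × Hist) (RHist R' : ℕ → ℝ)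
    (gIns : ∀ k i, Hist → C.Dom → α k i → ℂ) (q : ∀ k i, Hist → C.Dom → Op → α k i → ℂ)
    (m G₀ : ℕ → ι → Hist → C.Dom → ℝ) : Prop :=
  ∀ k, ∀ g ∈ W, ∀ (U : C.BgB), ∀ h ∈ closedBall (ctr k g U).2 (RHist k), ∀ X : C.Dom, C.scale X = k → ∀ i,
    0 < m k i h X ∧ AEStronglyMeasurable (gIns k i h X) volume ∧
    (∀ v, ‖gIns k i h X v‖ ≤ G₀ k i h X * Real.exp (m k i h X / 2 * ‖v‖ ^ 2)) ∧
    (∀ o ∈ ball (ctr k g U).1 (R' k), AEStronglyMeasurable (q k i h X o) volume) ∧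
    (∀ v, DifferentiableOn ℂ (fun o => q k i h X o v) (ball (ctr k g U).1 (R' k))) ∧
    (∀ o ∈ ball (ctr k g U).1 (R' k), ∀ v, m k i h X * ‖v‖ ^ 2 ≤ (q k i h X o v).re) ∧
    (∀ o ∈ ball (ctr k g U).1 (R' k), T k i o h X = ∫ v, gIns k i h X v * Complex.exp (-q k i h X o v))

variable {T}

omit [NormedSpace ℂ Hist] in
/-- **COMPLEX GAUSSIAN TERM FAMILIES SATISFY THE BALL FORM** of `OutputRateOpHolomorphic` with the reference measures Lebesgue on `α k i`,
the integrands `gIns(v)·exp(−q(o, v))` and the majorants `G₀e^{−(m/2)‖v‖²}` (§2 at each `(k, h, X, i)`). [folklore] -/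
theorem termOpHolomorphicBall_of_gaussian {W : Set (ℕ → ℝ)} {ctr : ℕ → (ℕ → ℝ) → C.BgB → Op × Hist} {RHist R' : ℕ → ℝ}
    {gIns : ∀ k i, Hist → C.Dom → α k i → ℂ} {q : ∀ k i, Hist → C.Dom → Op → α k i → ℂ} {m G₀ : ℕ → ι → Hist → C.Dom → ℝ}
    (hG : TermOpGaussian T W ctr RHist R' gIns q m G₀) :
    TermOpHolomorphicBall T W ctr RHist R' (fun (k : ℕ) (i : ι) (_ : Hist) (_ : C.Dom) => (volume : Measure (α k i)))
      fun k i h X o v => gIns k i h X v * Complex.exp (-q k i h X o v) := by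
  intro k g hg U h hh X hX i
  obtain ⟨hm, hgm, hgb, hqm, hqh, hqre, hrepr⟩ := hG k g hg U h hh X hX i
  obtain ⟨hmeas, hdiff, hint, hdom⟩ := gaussianTerm_clauses hm hgm hgb hqm hqh hqre
  exact ⟨hmeas, hdiff, ⟨_, hint, hdom⟩, hrepr⟩

omit [NormedSpace ℂ Hist] in
/-- Hence `TermOpLineAnalytic` on the ball class for complex Gaussian term families (room `ROp k < R′ k`) — NO analyticity hypothesis on
the operator species left, only the MARGIN. [folklore] -/
theorem termOpLineAnalytic_of_gaussian {W : Set (ℕ → ℝ)} {ctr : ℕ → (ℕ → ℝ) → C.BgB → Op × Hist} {ROp RHist R' : ℕ → ℝ}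
    {gIns : ∀ k i, Hist → C.Dom → α k i → ℂ} {q : ∀ k i, Hist → C.Dom → Op → α k i → ℂ} {m G₀ : ℕ → ι → Hist → C.Dom → ℝ}
    (hroom : ∀ k, ROp k < R' k) (hG : TermOpGaussian T W ctr RHist R' gIns q m G₀) :
    TermOpLineAnalytic (ballClass ctr ROp RHist) T W :=
  termOpLineAnalytic_of_ball hroom (termOpHolomorphicBall_of_gaussian hG)

omit [NormedSpace ℂ Hist] in
/-- And `TermBound` on the ball class from the Gaussian MASS budget `G₀·(π/(m/2))^{dim(α k i)/2} ≤ a k i·e^{−κd(X)}`. [folklore] -/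
theorem termBound_of_gaussian {W : Set (ℕ → ℝ)} {ctr : ℕ → (ℕ → ℝ) → C.BgB → Op × Hist} {ROp RHist R' : ℕ → ℝ}
    {gIns : ∀ k i, Hist → C.Dom → α k i → ℂ} {q : ∀ k i, Hist → C.Dom → Op → α k i → ℂ} {m G₀ : ℕ → ι → Hist → C.Dom → ℝ}
    (hroom : ∀ k, ROp k < R' k) (hG : TermOpGaussian T W ctr RHist R' gIns q m G₀) {κ : ℝ} {a : ℕ → ι → ℝ}
    (hbudget : ∀ k, ∀ g ∈ W, ∀ (U : C.BgB), ∀ h ∈ closedBall (ctr k g U).2 (RHist k), ∀ X : C.Dom, C.scale X = k → ∀ i,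
      G₀ k i h X * (Real.pi / (m k i h X / 2)) ^ (Module.finrank ℝ (α k i) / 2 : ℝ) ≤ a k i * Real.exp (-(κ * C.d X))) :
    TermBound (ballClass ctr ROp RHist) T W κ a := by
  refine termBound_of_ball_majorant hroom (termOpHolomorphicBall_of_gaussian hG) fun k g hg U h hh X hX i => ?_
  obtain ⟨hm, hgm, hgb, hqm, hqh, hqre, -⟩ := hG k g hg U h hh X hX i
  obtain ⟨-, -, hint, hdom⟩ := gaussianTerm_clauses hm hgm hgb hqm hqh hqre
  refine ⟨_, hint, hdom, ?_⟩
  rw [integral_const_mul_exp_neg_mul_sq_norm (half_pos hm)]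
  exact hbudget k g hg U h hh X hX i

end Hook

end Summit.QuantumFields.BalabanUV.T4Continuum.OutputRateOpGaussian

end
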